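import Summits.CriticalPhenomena.Ising3D.TaylorRegionCertsHP
import Mathlib.Tactic.Linarith
import Mathlib.Tactic.Positivity
import Mathlib.Tactic.Ring
import HarnessLib

/-!
# The even discriminant by TAYLOR MODELS on each piece (kernel-cost repair of the local-product test)
(cell `pub-ising3x`, seat recog-1 gen 11; gate (g2) — the tree's `Literature.Analysis.ValidatedNumerics.TaylorModel`
(`ttruncI`, `tmulI`, `tlowerI`) applied to the three table rows on a piece)

HONEST FRAMING: lottery ticket; floor = tightest certified 3D Ising CFT bounds; no exact-solution
claim without a proof. Island framing: certified exclusion region at stated derivative order and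
assumptions; not a determination of the 3D Ising critical exponents beyond that.

On a piece `|E − c| ≤ h` the rows `X, Y, Z` (degree `≈ 2Λ` interval polynomials) are shifted to `c` and TRUNCATED to
degree `Dg` Taylor models (`rowTM`: the dropped tail is folded into the constant coefficient, `ttruncI`); the
discriminant `4XY − Z²` is formed with truncated products (`tmulI`) and its range lower bound `tlowerI` must be
positive (`posCoreDT`). MEASURED (Python twin, vanilla Λ = 11 table, scale 2^64): with `Dg = 3…4` the bisection
needs the same number of pieces as the exact local product (`≈ 90` per row) while a piece costs `O(Dg²)` instead of
`O((2Λ)²)` interval products. `posOnDT` / `rowPosDT` + soundness; `EvenRegionDataH.checkPT Dg` (= `checkPD` with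
these rows) and **`taylorEvenRegion_of_evenRegionCheckHPT`**; turnkey `EvenRegionCertH.checkPT`,
`TaylorTable.evenRegion_of_evenCertHPT`, capstones **`boxExcluded_of_taylorTable_dec_of_certsHPT`**, `gammaCheckHPT`.
Elementary. [folklore]
-/

namespace Summit.CriticalPhenomena.Ising3D

open Finset Set
open Literature.Analysis.ValidatedNumerics Literature.Analysis.ValidatedNumerics.PolyMP
open Literature.Analysis.ValidatedNumerics.NumericsMP (MI)
open Literature.MathematicalPhysics.QuantumFieldTheory.ConformalBootstrap3D

/-! ### Taylor models of rows and of the discriminant on a piece -/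

/-- Degree-`Dg` Taylor model of a row on `|ρ| ≤ h` around the centre `C`. [folklore] -/
def rowTM (S : ℕ) (h : ℚ) (Dg : ℕ) (P : IPoly) (C : MI) : IPoly := ttruncI S h Dg (shiftI S P C)

/-- [folklore] -/
theorem tmem_rowTM {S : ℕ} (hS : 0 < S) {h : ℚ} (h0 : 0 ≤ h) (Dg : ℕ) {as : List ℝ} {P : IPoly}
    (has : PMem S as P) {c : ℝ} {C : MI} (hc : MI.mem S c C) :
    TMem S h (fun ρ => evalR as (c + ρ)) (rowTM S h Dg P C) :=
  tmem_trunc h0 Dg fun ρ _ => ⟨shiftR as c, pmem_shiftI hS hc has, by rw [evalR_shiftR]⟩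

/-- Taylor model of `4XY − Z²` on the piece. [folklore] -/
def discTM (S : ℕ) (h : ℚ) (Dg : ℕ) (RX RY RZ : IPoly) (C : MI) : IPoly :=
  taddI (tsmulInt 4 (tmulI S h Dg (rowTM S h Dg RX C) (rowTM S h Dg RY C)))
    (tsmulInt (-1) (tmulI S h Dg (rowTM S h Dg RZ C) (rowTM S h Dg RZ C)))

/-- [folklore] -/
theorem tmem_discTM {S : ℕ} (hS : 0 < S) {h : ℚ} (h0 : 0 ≤ h) (Dg : ℕ) {ax ay az : List ℝ}
    {RX RY RZ : IPoly} (hx : PMem S ax RX) (hy : PMem S ay RY) (hz : PMem S az RZ) {c : ℝ} {C : MI}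
    (hc : MI.mem S c C) :
    TMem S h (fun ρ => ((4 : ℤ) : ℝ) * (evalR ax (c + ρ) * evalR ay (c + ρ)) +
      ((-1 : ℤ) : ℝ) * (evalR az (c + ρ) * evalR az (c + ρ))) (discTM S h Dg RX RY RZ C) :=
  tmem_add (tmem_smulInt 4 (tmem_mul hS h0 Dg (tmem_rowTM hS h0 Dg hx hc) (tmem_rowTM hS h0 Dg hy hc)))
    (tmem_smulInt (-1) (tmem_mul hS h0 Dg (tmem_rowTM hS h0 Dg hz hc) (tmem_rowTM hS h0 Dg hz hc)))

/-! ### Sign tests -/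

/-- One piece `[lo, hi]`: the Taylor-model lower bound of the discriminant is positive. [folklore] -/
def posCoreDT (S Dg : ℕ) (RX RY RZ : IPoly) (lo hi : ℚ) : Bool :=
  decide (0 < tlowerI S ((hi - lo) / 2) (discTM S ((hi - lo) / 2) Dg RX RY RZ (PolyMP.ofRat S ((lo + hi) / 2))))

/-- [folklore] -/
theorem posCoreDT_sound {S Dg : ℕ} (hS : 0 < S) {RX RY RZ : IPoly} {lo hi : ℚ}
    (h : posCoreDT S Dg RX RY RZ lo hi = true) (hle : lo ≤ hi) {ax ay az : List ℝ} (hx : PMem S ax RX)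
    (hy : PMem S ay RY) (hz : PMem S az RZ) {x : ℝ} (hlo : (lo : ℝ) ≤ x) (hhi : x ≤ hi) :
    evalR az x * evalR az x < 4 * (evalR ax x * evalR ay x) := by
  simp only [posCoreDT, decide_eq_true_eq] at h
  have h0 : (0 : ℚ) ≤ (hi - lo) / 2 := by linarith
  have hρ : |x - (((lo + hi) / 2 : ℚ) : ℝ)| ≤ (((hi - lo) / 2 : ℚ) : ℝ) := by
    push_cast; rw [abs_le]; constructor <;> linarith
  have htm := tmem_discTM hS h0 Dg hx hy hz (mem_ofRat S ((lo + hi) / 2))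
  have hl := tlowerI_le h0 htm hρ
  have hpos : (0 : ℝ) < (tlowerI S ((hi - lo) / 2)
      (discTM S ((hi - lo) / 2) Dg RX RY RZ (PolyMP.ofRat S ((lo + hi) / 2))) : ℝ) := by exact_mod_cast h
  have e : (((lo + hi) / 2 : ℚ) : ℝ) + (x - (((lo + hi) / 2 : ℚ) : ℝ)) = x := by ring
  simp only [e, Int.cast_ofNat, Int.cast_neg, Int.cast_one] at hl
  have hSpos : (0 : ℝ) < S := by exact_mod_cast hS
  nlinarith

/-- Bisection to depth `d`. [folklore] -/
def posOnDT (S Dg : ℕ) (RX RY RZ : IPoly) : ℕ → ℚ → ℚ → Bool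
  | 0, a, b => posCoreDT S Dg RX RY RZ a b
  | d + 1, a, b =>
      posCoreDT S Dg RX RY RZ a b ||
        (posOnDT S Dg RX RY RZ d a ((a + b) / 2) && posOnDT S Dg RX RY RZ d ((a + b) / 2) b)

/-- [folklore] -/
theorem posOnDT_sound {S Dg : ℕ} (hS : 0 < S) {RX RY RZ : IPoly} {ax ay az : List ℝ} (hx : PMem S ax RX)
    (hy : PMem S ay RY) (hz : PMem S az RZ) : ∀ {d : ℕ} {lo hi : ℚ},
    posOnDT S Dg RX RY RZ d lo hi = true → lo ≤ hi →
      ∀ {x : ℝ}, (lo : ℝ) ≤ x → x ≤ hi → evalR az x * evalR az x < 4 * (evalR ax x * evalR ay x)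
  | 0, _, _, h, hle, _, hlo, hhi => posCoreDT_sound hS h hle hx hy hz hlo hhi
  | d + 1, a, b, h, hle, x, hlo, hhi => by
      simp only [posOnDT, Bool.or_eq_true, Bool.and_eq_true] at h
      rcases h with h | ⟨h1, h2⟩
      · exact posCoreDT_sound hS h hle hx hy hz hlo hhi
      · have hm1 : a ≤ (a + b) / 2 := by linarith
        have hm2 : (a + b) / 2 ≤ b := by linarith
        have hmR : (((a + b) / 2 : ℚ) : ℝ) = ((a : ℝ) + b) / 2 := by push_cast; ring
        rcases le_or_gt x (((a : ℝ) + b) / 2) with hxm | hxm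
        · exact posOnDT_sound hS hx hy hz h1 hm1 hlo (by rw [hmR]; exact hxm)
        · exact posOnDT_sound hS hx hy hz h2 hm2 (by rw [hmR]; exact hxm.le) hhi

/-- Taylor-model discriminant test on `[max(E₀, j) − cc, E₁ − cc]`, skipped when empty. [folklore] -/
def rowPosDT (S Dg dP : ℕ) (RX RY RZ : IPoly) (E0 E1 cc : ℚ) (j : ℕ) : Bool :=
  decide (E1 < max E0 (j : ℚ)) || posOnDT S Dg RX RY RZ dP (max E0 (j : ℚ) - cc) (E1 - cc)

/-- [folklore] -/
theorem disc_of_rowPosDT {S Dg : ℕ} (hS : 0 < S) {dP : ℕ} {RX RY RZ : IPoly} {E0 E1 cc : ℚ} {j : ℕ}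
    (h : rowPosDT S Dg dP RX RY RZ E0 E1 cc j = true) {ax ay az : List ℝ} (hx : PMem S ax RX) (hy : PMem S ay RY)
    (hz : PMem S az RZ) {E : ℝ} (hE0 : (E0 : ℝ) ≤ E) (hjE : (j : ℝ) ≤ E) (hE1 : E ≤ E1) :
    evalR az (E - cc) * evalR az (E - cc) < 4 * (evalR ax (E - cc) * evalR ay (E - cc)) := by
  simp only [rowPosDT, Bool.or_eq_true, decide_eq_true_eq] at h
  have hlo : ((max E0 (j : ℚ) : ℚ) : ℝ) ≤ E := by push_cast; exact max_le hE0 hjE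
  rcases h with hvac | hpos
  · exfalso
    have : ((E1 : ℚ) : ℝ) < ((max E0 (j : ℚ) : ℚ) : ℝ) := by exact_mod_cast hvac
    linarith
  · have hle : max E0 (j : ℚ) - cc ≤ E1 - cc := by
      have : ((max E0 (j : ℚ) : ℚ) : ℝ) ≤ (E1 : ℝ) := hlo.trans hE1
      have : max E0 (j : ℚ) ≤ E1 := by exact_mod_cast this
      linarith
    have h' := hlo
    push_cast at h'
    exact posOnDT_sound hS hx hy hz hpos hle (by push_cast; linarith) (by push_cast; linarith)

/-! ### Even check with Taylor-model discriminant rows -/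

namespace EvenRegionDataH

/-- `checkP` with Taylor-model discriminant rows of truncation degree `Dg`. [folklore] -/
def checkPT (d : EvenRegionDataH) (Dg : ℕ) : Bool :=
  decide (0 < d.S) && decide (0 < d.E0) && decide (d.E1 ≤ (d.J1 : ℚ) + 1) && momLenOK d.N d.R &&
  kernelSizeOK d.S (d.cQ 0) (-1) d.sσI d.ccQ d.l d.N && kernelSizeOK d.S (d.cQ 1) (-1) d.sεI d.ccQ d.l d.N &&
  kernelSizeOK d.S (d.cQ 3) (-1) d.sbI d.ccQ d.l d.N && kernelSizeOK d.S (d.cQ 4) 1 d.sbI d.ccQ d.l d.N &&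
  decide (1 ≤ d.prmX.θhi) && decide (1 ≤ d.prmY.θhi) && decide (1 ≤ d.prmD.θhi) &&
  halfStripPos2 d.S d.TX (d.E1 - d.ccQ) d.prmX && halfStripPos2 d.S d.TY (d.E1 - d.ccQ) d.prmY &&
  halfStripPosD d.S d.TX d.TY d.TZ (d.E1 - d.ccQ) d.prmD &&
  (List.range (d.J1 + 1)).all fun j =>
    rowPosP d.S d.dPj (d.PX j) d.E0 d.E1 d.ccQ j && rowPosP d.S d.dPj (d.PY j) d.E0 d.E1 d.ccQ j &&
      rowPosDT d.S Dg d.dPj (d.PX j) (d.PY j) (d.PZ j) d.E0 d.E1 d.ccQ j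

end EvenRegionDataH

/-- **The even region from `checkPT`** (statement of `taylorEvenRegion_of_evenRegionCheckH`). [folklore] -/
theorem taylorEvenRegion_of_evenRegionCheckHPT (d : EvenRegionDataH) (Dg : ℕ) (hl : d.l.Nodup) (Q : Set (ℝ × ℝ))
    (hQ : ∀ p ∈ Q, MI.mem d.S p.1 d.sσI ∧ MI.mem d.S p.2 d.sεI ∧ MI.mem d.S ((p.1 + p.2) / 2) d.sbI)
    (h : d.checkPT Dg = true) :
    TaylorEvenRegion (taylorCrossing (1 / 2) (1 / 2) d.l.toFinset fun i ab => (d.cQ i ab : ℝ)) Q ((d.E0 : ℚ) : ℝ) := by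
  simp only [EvenRegionDataH.checkPT, Bool.and_eq_true, decide_eq_true_eq] at h
  obtain ⟨⟨⟨⟨⟨⟨⟨⟨⟨⟨⟨⟨⟨⟨hS, hE0⟩, hJ1⟩, hR⟩, hN0⟩, hN1⟩, hN3⟩, hN4⟩, hθX⟩, hθY⟩, hθD⟩, hX⟩, hY⟩, hD⟩, hrows⟩ := h
  refine taylorEvenRegion_half_of_qRegion _ _ Q _ fun p hp E j hE hj => ?_
  obtain ⟨hsσ, hsε, hsb⟩ := hQ p hp
  have hEpos : 0 < E := lt_of_lt_of_le (by exact_mod_cast hE0) hE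
  by_cases hE1 : ((d.E1 : ℚ) : ℝ) ≤ E
  · have hθ := div_mem_unit hEpos hj
    have hP : ((d.E1 - d.ccQ : ℚ) : ℝ) ≤ E - d.ccQ := by push_cast; linarith
    have eX := qSum_eq_eval2_momTable hS (d.cQ 0) (-1) hsσ d.ccQ hl hN0 hR hEpos j
    have eY := qSum_eq_eval2_momTable hS (d.cQ 1) (-1) hsε d.ccQ hl hN1 hR hEpos j
    have eZ3 := qSum_eq_eval2_momTable hS (d.cQ 3) (-1) hsb d.ccQ hl hN3 hR hEpos j
    have eZ4 := qSum_eq_eval2_momTable hS (d.cQ 4) 1 hsb d.ccQ hl hN4 hR hEpos j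
    have pX := pmem2_momTableI hS (d.cQ 0) (-1) hsσ d.ccQ d.l d.N d.R
    have pY := pmem2_momTableI hS (d.cQ 1) (-1) hsε d.ccQ d.l d.N d.R
    have pZ := pmem2_add2I (pmem2_momTableI hS (d.cQ 3) (-1) hsb d.ccQ d.l d.N d.R)
      (pmem2_momTableI hS (d.cQ 4) 1 hsb d.ccQ d.l d.N d.R)
    have vX := halfStripPos2_sound hS pX hX hP hθ.1 (hθ.2.trans (by exact_mod_cast hθX))
    have vY := halfStripPos2_sound hS pY hY hP hθ.1 (hθ.2.trans (by exact_mod_cast hθY))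
    have vD := halfStripPosD_sound hS pX pY pZ hD hP hθ.1 (hθ.2.trans (by exact_mod_cast hθD))
    rw [eval2_add2] at vD
    simp only [Rat.cast_neg, Rat.cast_one] at eX eY eZ3 eZ4
    have goalD : (qSum (fun ab => (d.cQ 3 ab : ℝ)) d.l.toFinset ((p.1 + p.2) / 2) (-1) E j +
        qSum (fun ab => (d.cQ 4 ab : ℝ)) d.l.toFinset ((p.1 + p.2) / 2) 1 E j) ^ 2 ≤
        4 * qSum (fun ab => (d.cQ 0 ab : ℝ)) d.l.toFinset p.1 (-1) E j *
          qSum (fun ab => (d.cQ 1 ab : ℝ)) d.l.toFinset p.2 (-1) E j := by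
      rw [eX, eY, eZ3, eZ4, sq]; linarith
    exact ⟨by rw [eX]; exact vX.le, by rw [eY]; exact vY.le, goalD⟩
  · have hElt : E < d.E1 := lt_of_not_ge hE1
    have hjJ : j < d.J1 + 1 := by
      have h1 : (j : ℝ) < (d.J1 : ℝ) + 1 := by
        have : ((d.E1 : ℚ) : ℝ) ≤ (d.J1 : ℝ) + 1 := by exact_mod_cast hJ1
        linarith
      exact_mod_cast h1
    have hrow := List.all_eq_true.mp hrows j (List.mem_range.mpr hjJ)
    simp only [Bool.and_eq_true] at hrow
    obtain ⟨⟨rX, rY⟩, rD⟩ := hrow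
    have pX := pmem_qRowOfTableI (pmem2_kernelPDLI_of_mem hS hsσ (d.cQ 0) (-1) d.ccQ d.l) d.N j
    have pY := pmem_qRowOfTableI (pmem2_kernelPDLI_of_mem hS hsε (d.cQ 1) (-1) d.ccQ d.l) d.N j
    have pZ := pmem_addI (pmem_qRowOfTableI (pmem2_kernelPDLI_of_mem hS hsb (d.cQ 3) (-1) d.ccQ d.l) d.N j)
      (pmem_qRowOfTableI (pmem2_kernelPDLI_of_mem hS hsb (d.cQ 4) 1 d.ccQ d.l) d.N j)
    have vX := pos_of_rowPosP hS rX pX hE hj hElt.le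
    have vY := pos_of_rowPosP hS rY pY hE hj hElt.le
    have vD := disc_of_rowPosDT hS rD pX pY pZ hE hj hElt.le
    rw [evalR_addR] at vD
    have eX := qSum_eq_evalR_qRowOfTable hS (d.cQ 0) (-1) hsσ d.ccQ hl hN0 E j
    have eY := qSum_eq_evalR_qRowOfTable hS (d.cQ 1) (-1) hsε d.ccQ hl hN1 E j
    have eZ3 := qSum_eq_evalR_qRowOfTable hS (d.cQ 3) (-1) hsb d.ccQ hl hN3 E j
    have eZ4 := qSum_eq_evalR_qRowOfTable hS (d.cQ 4) 1 hsb d.ccQ hl hN4 E j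
    simp only [Rat.cast_neg, Rat.cast_one] at eX eY eZ3 eZ4 vX vY vD
    have goalD : (qSum (fun ab => (d.cQ 3 ab : ℝ)) d.l.toFinset ((p.1 + p.2) / 2) (-1) E j +
        qSum (fun ab => (d.cQ 4 ab : ℝ)) d.l.toFinset ((p.1 + p.2) / 2) 1 E j) ^ 2 ≤
        4 * qSum (fun ab => (d.cQ 0 ab : ℝ)) d.l.toFinset p.1 (-1) E j *
          qSum (fun ab => (d.cQ 1 ab : ℝ)) d.l.toFinset p.2 (-1) E j := by
      rw [eX, eY, eZ3, eZ4, sq]; linarith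
    exact ⟨by rw [eX]; exact vX.le, by rw [eY]; exact vY.le, goalD⟩

/-! ### Turnkey and capstone -/

namespace EvenRegionCertH

/-- Table rows, Taylor-model discriminant of degree `Dg`. [folklore] -/
def checkPT (c : EvenRegionCertH) (Dg : ℕ) : Bool := decide c.l.Nodup && c.data.checkPT Dg

end EvenRegionCertH

/-- [folklore] -/
theorem taylorEvenRegion_of_certHPT (c : EvenRegionCertH) (Dg : ℕ) (h : c.checkPT Dg = true) :
    TaylorEvenRegion (taylorCrossing (1 / 2) (1 / 2) c.l.toFinset fun i ab => (c.cQ i ab : ℝ))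
      (Icc (c.box.σlo : ℝ) c.box.σhi ×ˢ Icc (c.box.εlo : ℝ) c.box.εhi) ((c.E0 : ℚ) : ℝ) := by
  simp only [EvenRegionCertH.checkPT, Bool.and_eq_true, decide_eq_true_eq] at h
  obtain ⟨hl, hd⟩ := h
  refine taylorEvenRegion_of_evenRegionCheckHPT c.data Dg hl _ (fun p hp => ?_) hd
  obtain ⟨h1, h2, h3, h4⟩ := BoxQ.bounds (B := c.box) hp
  refine ⟨mem_enclQ _ h1 h2, mem_enclQ _ h3 h4, mem_enclQ _ ?_ ?_⟩
  · push_cast; linarith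
  · push_cast; linarith

namespace TaylorTable

variable (T : TaylorTable)

/-- [folklore] -/
theorem evenRegion_of_evenCertHPT (π : EvenRegionParamsH) (Dg : ℕ) (h : (T.evenCertH π).checkPT Dg = true) :
    TaylorEvenRegion T.α T.box ((T.E₀ : ℚ) : ℝ) :=
  taylorEvenRegion_of_certHPT (T.evenCertH π) Dg h

/-- **All-Boolean capstone, table rows with Taylor-model discriminant.** [folklore] -/
theorem boxExcluded_of_taylorTable_dec_of_certsHPT (h : T.check = true) (he : T.checkEncl = true)
    (πE : EvenRegionParamsH) (Dg : ℕ) (hE : (T.evenCertH πE).checkPT Dg = true)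
    (πO : OddConeParamsH) (hO : (T.oddCertH πO).checkP = true) : BoxExcluded T.box :=
  T.boxExcluded_of_taylorTable_dec h he (T.evenRegion_of_evenCertHPT πE Dg hE) (T.oddCone_of_oddCertHP πO hO)

/-- The four Booleans as ONE (table rows, Taylor-model discriminant). [folklore] -/
def gammaCheckHPT (πE : EvenRegionParamsH) (Dg : ℕ) (πO : OddConeParamsH) : Bool :=
  T.check && T.checkEncl && (T.evenCertH πE).checkPT Dg && (T.oddCertH πO).checkP

/-- [folklore] -/
theorem boxExcluded_of_gammaCheckHPT (πE : EvenRegionParamsH) (Dg : ℕ) (πO : OddConeParamsH)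
    (h : T.gammaCheckHPT πE Dg πO = true) : BoxExcluded T.box := by
  simp only [gammaCheckHPT, Bool.and_eq_true] at h
  obtain ⟨⟨⟨h1, h2⟩, h3⟩, h4⟩ := h
  exact T.boxExcluded_of_taylorTable_dec_of_certsHPT h1 h2 πE Dg h3 πO h4

end TaylorTable

/-! ### Fixture -/

/-- [folklore] -/
theorem toyEvenRegionCertH_checkPT : toyEvenRegionCertH.checkPT 2 = true := by
  decide +kernel

end Summit.CriticalPhenomena.Ising3D
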